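import Literature.MathematicalPhysics.QuantumFieldTheory.Balaban1983to89.B1Claim18RegularTorusFam

/-!
# `Balaban1983to89.B1Claim18RegularRegionFam` — [Balaban1983RegularityDecay] **§1, THE IN-TEXT CLAIM (1.8)** p. 573, TYPED (`B4.Claim18Printed`),
# **FOR THE (Higgs)₂,₃ CARRIER AT EVERY VECTOR FIELD (2.23)-REGULAR ON A REGION `Ω ⊂ T_ε`** (any union of `k`-fold blocks, any level
# `1 ≤ k ≤ K`, any torus): the family of `B4.EtaSetting`s built from the typer's `HiggsCovariance.covOpK C Ω A 0 a k` =
# `−Δ^{ε,N}_{A,Ω} + a_k(L^kε)^{−2}P_k(A)` on the fields supported in `Ω`, with (1.8) = r14 g14's `B1Ineq18RegularRegion.coercive_covOpK_of_reg223`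
# (p322399) — the REGION companion of p35 g11's `B1Claim18RegularTorusFam` (`Ω = T_ε`); «The constant γ₀ is independent of the lattice
# spacing η, as well as of Ω and of A»

statement-level skeleton of published theorems with citation tags; proofs where landed; nothing here is a claim about the Yang–Mills mass gap

PDF held: `paper:balaban1983-cmp89-regularity-decay` p. 573 [PDF 3] ((1.6)–(1.8), «We consider subsets Ω which are unions of big blocks»),
p. 572 [PDF 2] ((1.3) Neumann form); [Balaban1982Higgs1] = `paper:balaban1982-cmp85-higgs23-i` p. 610 [PDF 8] (2.20)–(2.23).

CITATION HEADER (lean-in-tree rule).  T. Bałaban, *Regularity and decay of lattice Green's functions*, Commun. Math. Phys. **89** (1983)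
571–597 [Balaban1983RegularityDecay], (1.8) p. 573; T. Bałaban, *(Higgs)₂,₃ quantum fields in a finite volume. I*, Commun. Math. Phys. **85**
(1982) 603–626 [Balaban1982Higgs1], Prop. 2.1 (2.23) p. 610.  Cell `lit-balaban` (HOME `run/shared/lean/pub/lit-balaban/`), reader/typer seat
**r14** gen 14 (unit `lit-balaban-r14`; TAKING line HOME/STATUS.md 2026-08-22T07:18:39Z); SKELETON rows **B1.Prop2.1** (cells; (1.8) = the operator
input of Prop. I.2.1) and r01's **B4.Claim18** (MODEL-INSTANCE cell only, no head change; decl of record `B4.Claim18Printed` is b04's).  USED BY NAME,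
never restated: b04 `B4.{EtaSetting, Claim18Printed}`; r14 g14 `B1Ineq18RegularRegion.coercive_covOpK_of_reg223`; p35 g11
`B1Claim18RegularTorusFam.{threshold_reg223, gamma18_pos}`; typer `HiggsLattice`, `HiggsCovariance.covOpK`, `HiggsAveraging.blockIter`.

WHAT IS PRINTED (verbatim, [13] p. 573 [PDF 3]): *"The operator defining the Green's function (1.6) has a strictly positive lower bound. More
exactly we prove that there exists a positive constant γ₀ such that for e sufficiently small and for a regular vector field A,
−Δ^{η,N}_{A,Ω} + aP_k(A) ≧ γ₀I. (1.8) The constant γ₀ is independent of the lattice spacing η, as well as of Ω and of A."*; p. 572: *"We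
consider subsets Ω which are unions of big blocks."*; [B1] p. 610 (2.23): «A regular on Ω» (bond-by-bond form, p35's rescaled dictionary).

THE FAMILY.  Index `i` = a torus `P` (`P.d = d`, `P.L = L`), a level `1 ≤ k ≤ K_P`, a region `Ω ⊂ T_ε` that is a union of `k`-fold blocks
(`hΩ`, part of the index — [13]'s standing «unions of big blocks», here WEAKER: unions of blocks), a vector field `A`, an effective coupling
`e_k`.  Fields of the `EtaSetting`: `e := e_k`; `regular` := (2.23) bond by bond AT THE SITES OF `Ω` in p35's rescaled form
`(L^kε|e|/e_k)|A_μ(z + εe_ν) − A_μ(z)| ≦ c·e_k^{β−1}/L^k`; `lower18 γ` := `γ⟨φ, φ⟩ ≦ (L^kε)²⟨φ, (−Δ^{ε,N}_{A,Ω} + a_k(L^kε)^{−2}P_k(A))φ⟩` for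
every `φ : T_ε → ℝ^N` SUPPORTED IN `Ω` (the unit-lattice operator (1.6) of [13] = `(L^kε)²·covOpK C Ω A 0 a k`, [B1] (2.22)); `bigBlocks := True`
(the block-union condition is in the index), `rect := False`; the (1.9)–(1.12)/(2.30) functionals (`lhs19`, `valDG`, `valG`, `dlhs19`, `dvalDG`,
`dvalG`, `pair`, `dpair`, the distances) are set to `0` — THIS family serves (1.8) only (the Theorem for regions at a regular `A` is p35's
region-cube programme; the four (2.30) pairings for regions at a regular `A` are r14 g14's `B1Cor23RegularRegion`/`B1Cor23DerivRegularRegion`).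

WHAT THIS FILE PROVES (kernel-checked, zero `sorry`; axioms standard).
* `RegRegion18Idx`, **`regRegionFam18`** (the family, all fields with bodies).
* **`lower18_regRegionFam18`**: (1.8) for every member — if `regular` and `0 < e_k ≦ e₁ = (3(d²c + 1))^{−1/β}` then `lower18 γ₀` with
  `γ₀ = min{2, a(1 − L^{−2})/4}` (r14's `coercive_covOpK_of_reg223` on `Ω`, `m² = 0`).
* **`claim18Printed_regRegionFam18`**: `B4.Claim18Printed (regRegionFam18 d L C a c β)` for every `d`, `L ≧ 2`, `a > 0`, `N`, `(e, q)`, `c ≧ 0`,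
  `β > 0` — γ₀ BEFORE the member: «independent of η, as well as of Ω and of A».
* `regRegionFam18_nonvacuous`: members with `regular ∧ 0 < e ≦ e₁` exist for every `e₁ > 0` (any torus/level/region, `A = 0`).
HONEST SCOPE.  (i) MODEL INSTANCE of the typed (1.8) on the concrete carrier for REGIONS; no head claim on row B4.Claim18 (r01's); (ii) `Ω` any
union of `k`-fold blocks (weaker than «big blocks»); regularity asked at the sites of `Ω` only; (iii) the threshold is r14's crude
`d²·c·e_k^β ≦ 1/3`; (iv) the other `EtaSetting` functionals are dummies (see THE FAMILY); (v) NOT summit progress.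
-/

noncomputable section

open scoped BigOperators

namespace Literature.MathematicalPhysics.QuantumFieldTheory.Balaban1983to89.B1Claim18RegularRegionFam

open Literature.MathematicalPhysics.QuantumFieldTheory.Balaban1983to89.HiggsLattice (ChargeData ScalarField siteInner)
open Literature.MathematicalPhysics.QuantumFieldTheory.Balaban1983to89.HiggsCovariance (covOpK)
open Literature.MathematicalPhysics.QuantumFieldTheory.Balaban1983to89.HiggsAveraging (blockIter)
open Literature.MathematicalPhysics.QuantumFieldTheory.Balaban1983to89.B1Ineq18RegularRegion (coercive_covOpK_of_reg223)
open Literature.MathematicalPhysics.QuantumFieldTheory.Balaban1983to89.B1Claim18RegularTorusFam (threshold_reg223 gamma18_pos)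
open Literature.MathematicalPhysics.QuantumFieldTheory.Balaban1983to89.B4 (EtaSetting Claim18Printed)

variable {N : ℕ}

/-! ## §1 The index set and the family -/

/-- An index of the family: torus, level, a region that is a union of `k`-fold blocks, vector field, effective coupling.
[cite: Balaban1983RegularityDecay, §1 (1.6)–(1.8) pp.572–573] -/
structure RegRegion18Idx (d L : ℕ) where
  /-- the torus of the carrier -/
  P : HiggsLattice.Params
  hPd : P.d = d
  hPL : P.L = L
  /-- the level `k` -/
  k : ℕ
  hk1 : 1 ≤ k
  hk : k ≤ P.K
  /-- the region `Ω ⊂ T_ε`, a union of `k`-fold blocks -/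
  Ω : Finset (HiggsLattice.Site P 0)
  hΩ : ∀ x x' : HiggsLattice.Site P 0, blockIter k x = blockIter k x' → (x ∈ Ω ↔ x' ∈ Ω)
  /-- the vector field on the bonds of `T_ε` -/
  A : HiggsLattice.VecField P 0
  /-- the effective coupling `e_k` -/
  ec : ℝ

/-- **THE FAMILY OF `EtaSetting`s OF THE (Higgs)₂,₃ CARRIER FOR (1.8) ON REGIONS AT A REGULAR FIELD** (module docstring «THE FAMILY» for the
reading of each field; the (1.9)–(1.12)/(2.30) functionals are dummies). [cite: Balaban1983RegularityDecay, §1 (1.6)–(1.8) pp.572–573]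
[cite: Balaban1982Higgs1, (2.20)–(2.23) p.610] -/
def regRegionFam18 (d L : ℕ) (C : ChargeData N) (a creg β : ℝ) (i : RegRegion18Idx d L) : EtaSetting where
  Site := HiggsLattice.Site i.P 0
  Dir := Fin i.P.d
  Src := ScalarField i.P 0 N
  e := i.ec
  regular := ∀ z ∈ i.Ω, ∀ μ ν : Fin i.P.d,
    i.P.mesh i.k * |C.e| / i.ec * |i.A ⟨z.shift ν, μ⟩ - i.A ⟨z, μ⟩| ≤ creg * i.ec ^ (β - 1) / (i.P.L : ℝ) ^ i.k
  bigBlocks := True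
  rect := False
  pdist := fun x y => (HiggsLattice.Site.tdist x y : ℝ) / (i.P.L : ℝ) ^ i.k
  sdist1 := fun _ _ => 0
  sdist2 := fun _ _ _ => 0
  bdist1 := fun _ => 0
  bdist2 := fun _ _ => 0
  bdistS := fun _ => 0
  supNorm := fun f => ‖f‖
  l2Norm := fun f => Real.sqrt (siteInner f f)
  ssdist := fun _ _ => 0
  lhs19 := fun _ _ _ _ _ => 0
  valDG := fun _ _ _ => 0
  valG := fun _ _ => 0
  dlhs19 := fun _ _ _ _ _ => 0
  dvalDG := fun _ _ _ => 0
  dvalG := fun _ _ => 0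
  lower18 := fun γ => ∀ φ : ScalarField i.P 0 N, (∀ x, x ∉ i.Ω → φ x = 0) →
    γ * siteInner φ φ ≤ i.P.mesh i.k ^ 2 * siteInner φ (covOpK C i.Ω i.A 0 a i.k φ)
  pair := fun _ _ _ _ _ => 0
  dpair := fun _ _ _ _ _ => 0

/-! ## §2 (1.8) on every member, and `Claim18Printed` -/

/-- **(1.8) FOR EVERY MEMBER OF `regRegionFam18`** (every torus, level, block-union region, vector field): if the member is `regular` ((2.23) at
the sites of `Ω`) and `0 < e_k ≦ e₁`, then `lower18 γ₀` with `γ₀ = min{2, a(1 − L^{−2})/4}`: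
`γ₀⟨φ, φ⟩ ≦ (L^kε)²⟨φ, (−Δ^{ε,N}_{A,Ω} + a_k(L^kε)^{−2}P_k(A))φ⟩` for every `φ` supported in `Ω` — r14's `coercive_covOpK_of_reg223`, `m² = 0`.
[cite: Balaban1983RegularityDecay, (1.8) p.573] [cite: Balaban1982Higgs1, (2.20), (2.22), Prop. 2.1 (2.23) p.610] -/
theorem lower18_regRegionFam18 (d L : ℕ) (hL : 2 ≤ L) {a : ℝ} (ha : 0 < a) (C : ChargeData N) {creg : ℝ} (hcreg : 0 ≤ creg)
    {β : ℝ} (hβ : 0 < β) :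
    ∃ e₁ : ℝ, 0 < e₁ ∧ ∀ i : RegRegion18Idx d L,
      (regRegionFam18 d L C a creg β i).regular → 0 < (regRegionFam18 d L C a creg β i).e →
      (regRegionFam18 d L C a creg β i).e ≤ e₁ →
        (regRegionFam18 d L C a creg β i).lower18 (min 2 (a * (1 - ((L : ℝ) ^ 2)⁻¹) / 4)) := by
  obtain ⟨e₁, he₁, hsm⟩ := threshold_reg223 d hcreg hβ
  refine ⟨e₁, he₁, fun i hreg hec hle => ?_⟩
  dsimp only [regRegionFam18] at hreg hec hle ⊢
  intro φ hφ
  have hPL1 : 1 < i.P.L := by rw [i.hPL]; omega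
  have hsmall : (i.P.d : ℝ) ^ 2 * creg * i.ec ^ β ≤ 1 / 3 := by rw [i.hPd]; exact hsm i.ec hec hle
  have h := coercive_covOpK_of_reg223 C ha hPL1 i.hk1 i.hk i.Ω i.hΩ i.A hec hreg hsmall 0 φ hφ
  rw [add_zero, i.hPL] at h
  have hm : 0 < i.P.mesh i.k := i.P.mesh_pos i.k
  have key : min 2 (a * (1 - ((L : ℝ) ^ 2)⁻¹) / 4) * siteInner φ φ
      = i.P.mesh i.k ^ 2 * (min 2 (a * (1 - ((L : ℝ) ^ 2)⁻¹) / 4) * ((i.P.mesh i.k)⁻¹ ^ 2) * siteInner φ φ) := by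
    field_simp
  rw [key]
  exact mul_le_mul_of_nonneg_left h (sq_nonneg _)

/-- **THE IN-TEXT CLAIM (1.8), TYPED (`B4.Claim18Printed`), FOR THE (Higgs)₂,₃ CARRIER AT EVERY FIELD (2.23)-REGULAR ON A REGION** — for every
`d`, `L ≧ 2`, `a > 0`, `N`, `(e, q)`, `c ≧ 0`, `β > 0`: `Claim18Printed (regRegionFam18 d L C a c β)` with the witnesses `γ₀ = min{2, a(1 − L^{−2})/4}`
(«independent of the lattice spacing η, as well as of Ω and of A») and `e₁ = (3(d²c + 1))^{−1/β}`. [cite: Balaban1983RegularityDecay, (1.8) p.573] -/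
theorem claim18Printed_regRegionFam18 (d L : ℕ) (hL : 2 ≤ L) {a : ℝ} (ha : 0 < a) (C : ChargeData N) {creg : ℝ} (hcreg : 0 ≤ creg)
    {β : ℝ} (hβ : 0 < β) :
    Claim18Printed (regRegionFam18 d L C a creg β) := by
  obtain ⟨e₁, he₁, h⟩ := lower18_regRegionFam18 (N := N) d L hL ha C hcreg hβ
  exact ⟨_, e₁, gamma18_pos ha hL, he₁, h⟩

/-- **The family is non-vacuous at every threshold**: for every torus with these `d, L`, every level `1 ≤ k ≤ K`, every block-union region and
every `0 < e_k ≦ e₁` the member with `A = 0` is `regular` (`c ≧ 0`). [cite: Balaban1983RegularityDecay, (1.8) p.573] -/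
theorem regRegionFam18_nonvacuous {d L : ℕ} (C : ChargeData N) (a : ℝ) {creg : ℝ} (hcreg : 0 ≤ creg) (β : ℝ)
    (P : HiggsLattice.Params) (hPd : P.d = d) (hPL : P.L = L) {k : ℕ} (hk1 : 1 ≤ k) (hk : k ≤ P.K)
    (Ω : Finset (HiggsLattice.Site P 0)) (hΩ : ∀ x x' : HiggsLattice.Site P 0, blockIter k x = blockIter k x' → (x ∈ Ω ↔ x' ∈ Ω))
    {e₁ : ℝ} (he₁ : 0 < e₁) :
    ∃ i : RegRegion18Idx d L,
      (regRegionFam18 d L C a creg β i).regular ∧ 0 < (regRegionFam18 d L C a creg β i).e ∧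
      (regRegionFam18 d L C a creg β i).e ≤ e₁ := by
  refine ⟨⟨P, hPd, hPL, k, hk1, hk, Ω, hΩ, 0, e₁⟩, ?_, he₁, le_rfl⟩
  dsimp only [regRegionFam18]
  intro z _ μ ν
  rw [Pi.zero_apply, Pi.zero_apply, sub_self, abs_zero, mul_zero]
  have hL0 : (0 : ℝ) ≤ (P.L : ℝ) ^ k := by positivity
  exact div_nonneg (mul_nonneg hcreg (Real.rpow_nonneg he₁.le _)) hL0

end Literature.MathematicalPhysics.QuantumFieldTheory.Balaban1983to89.B1Claim18RegularRegionFam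

end
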